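import Summits.QuantumFields.BalabanUV.T4Continuum.Support.NE3EnergyRateWSupRoutePiRInv
import Summits.QuantumFields.BalabanUV.T4Continuum.Support.NE3ClassRadiusFamily
import HarnessLib

/-!
# T⁴ programme, node NE3 — route Π, file 6f: THE JOIN OF 6c AND 6e — the END of route Π with the linear normal part BY NAME (`Nn := rightInvW …`,
# file 6e) AND with the class family `hsmall` ∕ the constant's sign `hCP` DISCHARGED by NE3-R2's `NE3ClassRadiusFamily` (file 6c's two substitutions)

Cell `pub-balaban-gaps` (YM blitz, track G2, seat `ne3`; writer prover-pub-balaban-gaps-ne3-g0-0, 2026-08-22), repair R6 of `run/shared/lean/pub/pub-balaban-gaps/ne/NE3.md`: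
the join OWED since the row's park (pub-balaban `t4/T4-NE3-TRIGGER.json` scope_update_97, t4-ref2 pass 99: «6c and 6e are PARALLEL children of 6bγ; their JOIN
(6e's shrunk hleaves AND 6c's k-free lines, one theorem = 6e's proof with 6c's two substitutions, or vice versa) IS NOT IN THE TREE»).  Inputs BY NAME: file 6e
`NE3EnergyRateWSupRoutePiRInv.ne3EnergyRateWSup_sfClass_routePi_rinv` (row NE3 owner `b2b-balaban-t4-ne3-p1` g26, p247216 — the most-assembled END), row NE3-R2's
K-g12-1 `NE3ClassRadiusFamily.levelSmall_family` ∕ `CPLine_nonneg` (p243801).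

WHAT.  **`ne3EnergyRateWSup_sfClass_routePi_final`** = `ne3EnergyRateWSup_sfClass_routePi_rinv` with `hsmall : ∀ j, LevelSmall d L (j+1) (ε∕(L^{j+2})²)`
REPLACED by the two k-free lines `16·(14464(d+1)²(d+4)²)·ε ≤ 3` and `2·twoLevelSmall d L·ε ≤ L²` (`levelSmall_family`), and `hCP : 0 ≤ CPLine d L (card n) εc θK`
REMOVED (a theorem for `0 < εc`, `0 < ε ≤ θK`: `CPLine_nonneg`).  After this file the displayed hypotheses of the local-half END over `sfClass` are EXACTLY: the class
numerics `hbs`∕`hbε'` and the two ε-lines, the K-road lines hK1–hK4 of (P♮)_W, the W6 regime `thetaLoc·ε < 1`, `ε ≤ 1`, route Π's constant∕ceilings∕four lines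
hℓ₁∕hℓ₃∕hℓ₄∕hℓ₅, the level∕regularity∕budget lines hJ1∕hJ2∕hreg₁∕hbudget — ALL k-FREE NUMERIC — and the ONE per-pair binder `hleaves` (the residual slice
representative adapted to the exact right inverse [leaf Π-L1♮], the weight with its local quadratic letter [Π-C-3γ over (Π-REG-γ)], three currencies).

HONEST FRAMING.  A two-substitution composition of accepted tree theorems; no mathematics.  T-E_w♯ and NE3 are NOT proved: `hleaves` is asserted for NO Bałaban
datum ((H∃) = [Balaban1985Variational] Thm 1 TYPE lives downstream in the consumers); the seat's census (`ne/NE3.md` §4 R2) reads `hleaves` and NE7's covariant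
Lipschitz conjuncts as [Balaban1985RegularSpaces] Thm 2 (1.36)∕(1.39) pp. 82–83 TYPE at the pair — a reading, NOT a kernel fact.  Spine PROVED 0∕9; finite T⁴ rung
(B)+1 — NOT infinite volume, NOT mass gap, NOT `BetaPertH`, NOT Clay.  PLACEMENT: `Summits/QuantumFields/BalabanUV/T4Continuum/Support/`.  HONEST DEPENDENCY:
continuum YM on T⁴ ⇐ BetaPertH ∧ nine spine estimates (0/9 proved); BetaPertH ⇐ (D1) ∧ (D4) ∧ CAP+tail; G-an2-4 gates asym, D1 and NE2/3/4.
-/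

set_option autoImplicit false

open scoped BigOperators Matrix.Norms.L2Operator
open NormedSpace Finset

namespace Summit.QuantumFields.BalabanUV.T4Continuum.NE3EnergyRateWSupRoutePiFinal

open Set
open Literature.MathematicalPhysics.QuantumFieldTheory.Balaban1983to89
open B7Prop1Explicit B7Prop2Explicit
open T4AveragingDeficitWall hiding Site Plane Plaq Bond
open T4AveragingDeficitWallBoundary (IsPeriodicCfg periodBox)
open AveragingDeficitPeriodicCounting (IsPeriodicDir)
open AveragingDeficitChartCalculus (cavg)
open AveragingDeficitTwoLevelPrep (twoLevelSmall)
open AveragingDeficitMultiLevelPrep (LevelSmall)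
open NE3CovariantLineSumsL2 (C2sq)
open NE3CovariantLineSumsL2Tower (rho)
open MinimalActionRate (sfClass Regular)
open MinimalActionSandwich (IsMinimiser)
open NE3TangentCovariantTower (dirIter)
open NE3EnergyWeightedSupShape (NE3EnergyRateWSup)
open NE3EnergyRateWSupOfSlicePoincare (cLambda)
open NE3SlicePoincareBudgetLine (ShLine SmallYLine CPLine)
open NE3DecomposedRepOfLinearNormalPart (ResidualSliceRepT)
open NE3EnergyRateWSupRoutePi (piRad piNu piKappa1 piKappa2)
open NE3EnergyRateWSupRoutePiRInv (ne3EnergyRateWSup_sfClass_routePi_rinv)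
open NE3QbarIterCovLiftPrep (cruxC)
open NE3SmoothRightInverseW (rightInvW)
open NE3RightInverseSupLetters (supC)
open NE3RightInverseSolveLetters (thetaLoc)
open NE3RightInverseL2Letter (l2C)
open NE3RightInverseL1Letter (l1C)
open NE3HatInvCurlLetters (supCurlC curl2C curl1C)
open NE3ClassRadiusFamily (levelSmall_family CPLine_nonneg)

noncomputable section

variable {d : ℕ} {n : Type*} [Fintype n] [DecidableEq n]

/-- **THE END OF ROUTE Π OVER `sfClass`, JOINED**: the right inverse's letters by name (file 6e) AND the class family ∕ the constant's sign discharged (file 6c's two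
substitutions).  Remaining displayed hypotheses: k-free numeric lines and the per-pair binder `hleaves` only (see the module docstring; every line is read as in
`NE3EnergyRateWSupRoutePiRInv.ne3EnergyRateWSup_sfClass_routePi_rinv`). [folklore] -/
theorem ne3EnergyRateWSup_sfClass_routePi_final [Nonempty n] (hd : 3 ≤ d) {L N : ℕ} [NeZero L] [NeZero N] (hL : 2 ≤ L) (hN : 1 ≤ N)
    {ε b g : ℝ} (hb : 0 ≤ b) (hbε : b < ε) (hg : 0 < g)
    (hbs : 512 * (d + 1) * (d + 4) * (L : ℝ) ^ 2 * b ≤ 1) (hbε' : b + 226 * (8 * (d + 1) * (d + 4)) ^ 2 * b ^ 2 ≤ ε)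
    -- the class family as two k-free lines (NE3-R2 K-g12-1 `levelSmall_family`)
    (hεK1 : 16 * (14464 * ((d : ℝ) + 1) ^ 2 * ((d : ℝ) + 4) ^ 2) * ε ≤ 3) (hεK2 : 2 * twoLevelSmall d L * ε ≤ (L : ℝ) ^ 2)
    -- the K-road lines of (P♮)_W
    {dom : Set (Site d → Fin d → (Matrix n n ℂ)ˣ)} {θK εc : ℝ} (hε : 0 < ε) (hεθ : ε ≤ θK) (hεc : 0 < εc)
    (hK1 : ShLine d L (Fintype.card n) εc θK ≤ 1 / 2) (hK2 : SmallYLine d L (Fintype.card n) εc θK ≤ 1 / 2)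
    (hK3 : 68 / 3 * (((d : ℝ) + 1) * ((d : ℝ) + 4)) * C2sq d L * θK ≤ rho d L / 2)
    (hK4 : 8 * d * (((d : ℝ) - 1) * θK) ^ 2
      + 2 * ((Fintype.card n : ℝ) * ((4 * (d : ℝ) ^ 2 + 272 * d * (((d : ℝ) + 1) * ((d : ℝ) + 4))) * θK) ^ 2) ≤ 1 / 2)
    -- the right inverse's regime (W5∕W6): `cruxC·ε ≤ thetaLoc·ε < 1`, `ε ≤ 1`
    (hθl : thetaLoc d L * ε < 1) (hε1 : ε ≤ 1)
    -- route Π: the quadratic-letter constant, the currencies' ceilings and FOUR uniform lines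
    {C₂ αh Ch Λ : ℝ} (hC₂ : 0 ≤ C₂) (hαh0 : 0 ≤ αh) (hCh0 : 0 ≤ Ch)
    (hℓ₁ : αh ≤ 1 / 100) (hℓ₃ : supC d L * (C₂ * αh ^ 2) / (1 - cruxC d L * ε) ≤ 1 / 2700)
    (hℓ₄ : 10 * (αh + 24 * (supC d L * (C₂ * αh ^ 2) / (1 - cruxC d L * ε))) ≤ 1)
    (hℓ₅ : 2 * (l2C d L / (1 - thetaLoc d L * ε) ^ 2 + curl2C d L / (1 - thetaLoc d L * ε) ^ 2) * C₂ ^ 2 * Ch ^ 2 * αh ^ 2 ≤ 1 / 2)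
    -- the level lines (J1)(J2), the regularity and budget lines of the END
    (hJ1 : (1 + 480 * Real.sqrt d * (αh + 24 * (supC d L * (C₂ * αh ^ 2) / (1 - cruxC d L * ε)))) ^ 2
      + 48 * d * piRad ε αh (supC d L * (C₂ * αh ^ 2) / (1 - cruxC d L * ε)) (supCurlC d L * (C₂ * αh ^ 2) / (1 - cruxC d L * ε)) ≤ Λ)
    (hJ2 : 112 * (d : ℝ) * piRad ε αh (supC d L * (C₂ * αh ^ 2) / (1 - cruxC d L * ε)) (supCurlC d L * (C₂ * αh ^ 2) / (1 - cruxC d L * ε))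
      * CPLine d L (Fintype.card n) εc θK ≤ 1 / (2 * (Fintype.card n : ℝ)))
    (hreg₁ : CPLine d L (Fintype.card n) εc θK * (Real.sqrt Λ - 1) ^ 2 ≤ 1 / 4)
    (hbudget : 2 * Λ * (2 * (1 + 4 * Real.sqrt (16 * d + 1))
          * piNu d (l2C d L / (1 - thetaLoc d L * ε) ^ 2) (curl2C d L / (1 - thetaLoc d L * ε) ^ 2) C₂ Ch αh)
        + Λ * (2 * (1 + 4 * Real.sqrt (16 * d + 1))
          * piNu d (l2C d L / (1 - thetaLoc d L * ε) ^ 2) (curl2C d L / (1 - thetaLoc d L * ε) ^ 2) C₂ Ch αh) ^ 2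
        + (2 * piKappa1 d (curl1C d L / (1 - thetaLoc d L * ε)) (l1C d L / (1 - thetaLoc d L * ε)) C₂ Ch ε αh
              (supC d L * (C₂ * αh ^ 2) / (1 - cruxC d L * ε)) (supCurlC d L * (C₂ * αh ^ 2) / (1 - cruxC d L * ε))
          + 912 * d * piKappa2 (l1C d L / (1 - thetaLoc d L * ε)) C₂ Ch ε αh
              (supC d L * (C₂ * αh ^ 2) / (1 - cruxC d L * ε)) (supCurlC d L * (C₂ * αh ^ 2) / (1 - cruxC d L * ε))) + 2 * 0
      ≤ cLambda n (CPLine d L (Fintype.card n) εc θK) Λ / 2)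
    -- THE RESIDUAL SLICE REPRESENTATIVE ADAPTED TO THE EXACT RIGHT INVERSE, THE WEIGHT WITH ITS QUADRATIC LETTER, THE CURRENCIES — per pair
    (hleaves : ∀ j : ℕ, ∀ V ∈ dom, ∀ UA UB : Site d → Fin d → (Matrix n n ℂ)ˣ,
      IsMinimiser d (sfClass d L N ε) L N (j + 1) V UA → IsMinimiser d (sfClass d L N ε) L N (j + 2) V UB →
        Regular d L N b g (j + 2) UB →
        ∃ (u : Site d → (Matrix n n ℂ)ˣ) (X₀ : Site d → Fin d → Matrix n n ℂ) (α₀ : ℝ) (m : Site d → Fin d → ℝ) (C : ℝ),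
          IsSkewDir X₀ ∧
          (∀ (hWu : IsUnitaryCfg (cavg L UB)) (hx : 0 ≤ ε / ((L : ℝ) ^ (j + 1)) ^ 2) (hs : LevelSmall d L j (ε / ((L : ℝ) ^ (j + 1)) ^ 2))
              (hWx : SmallField (cavg L UB) (ε / ((L : ℝ) ^ (j + 1)) ^ 2))
              (hθ : cruxC d L * (((L : ℝ) ^ (j + 1)) ^ 2 * (ε / ((L : ℝ) ^ (j + 1)) ^ 2)) < 1)
              (hφ : IsSkewDir (dirIter L (j + 1) (cavg L UB) X₀)),
            ResidualSliceRepT L N (j + 1) (cavg L UB) UA u X₀ (rightInvW hL j hWu hx hs hWx N hθ hφ) α₀) ∧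
          (∀ z κ, 0 ≤ m z κ) ∧ 0 ≤ C ∧
          ((L : ℝ) ^ (j + 1)) ^ d * ∑ z ∈ periodBox (d := d) N, ∑ κ : Fin d, m z κ ^ 2
            ≤ C ^ 2 * dirSq X₀ (periodBox (d := d) (N * L ^ (j + 1))) ∧
          (∀ z ∈ periodBox (d := d) N, ∀ κ : Fin d,
            ‖dirIter L (j + 1) (cavg L UB) X₀ z κ‖ ≤ C₂ * ((L : ℝ) ^ (j + 1) * m z κ) ^ 2) ∧
          α₀ * (L : ℝ) ^ (j + 1) ≤ αh ∧ (∀ z κ, m z κ * (L : ℝ) ^ (j + 1) ≤ αh) ∧ C ≤ Ch) :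
    NE3EnergyRateWSup d (sfClass d L N ε) L N b g
      ((1 + (piNu d (l2C d L / (1 - thetaLoc d L * ε) ^ 2) (curl2C d L / (1 - thetaLoc d L * ε) ^ 2) C₂ Ch αh
          + 23 * Real.sqrt 2 * Real.sqrt (16 * d + 1)
            * (1 + piNu d (l2C d L / (1 - thetaLoc d L * ε) ^ 2) (curl2C d L / (1 - thetaLoc d L * ε) ^ 2) C₂ Ch αh)))
        * (4 / cLambda n (CPLine d L (Fintype.card n) εc θK) Λ)
        * (Real.sqrt ((L : ℝ) ^ (d - 2))
            + (Real.sqrt ((L : ℝ) ^ (d - 2)) * Real.sqrt (8 * Fintype.card (T4AveragingDeficitWall.Plane d))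
                * (128 * (d * (L : ℝ) ^ 2))
              + 2 * (2048 * ((d : ℝ) + 4) ^ 2 * (L : ℝ) ^ 2 * Real.sqrt (d * (L : ℝ) ^ d))) * b
            + b ^ 2 * (2 * (L : ℝ) ^ (d - 1) + 2 * (8 * d * (L : ℝ) ^ d)) * Real.sqrt (d / (g * (L : ℝ) ^ (d + 2)))))
      ((Real.sqrt Λ - 1) / (24 * Real.sqrt d)) dom :=
  ne3EnergyRateWSup_sfClass_routePi_rinv hd hL hN hb hbε hg hbs hbε' (levelSmall_family hL hε.le hεK1 hεK2) hε hεθ hεc hK1 hK2 hK3 hK4 hθl hε1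
    hC₂ hαh0 hCh0 hℓ₁ hℓ₃ hℓ₄ hℓ₅ (CPLine_nonneg (by omega) (Nat.cast_nonneg _) hεc.le (hε.le.trans hεθ)) hJ1 hJ2 hreg₁ hbudget hleaves

/-- The d = 4, L = 2 instance of the two ε-lines that replaced `hsmall`: they hold for every `ε ≤ 10⁻¹¹` (NE3-R2's `levelSmall_family_d4_L2` regime, re-derived
here as plain arithmetic so that the END's class-family price is visible as ONE number; no sign hypothesis is needed). [folklore] -/
theorem epsLines_d4_L2 {ε : ℝ} (hε : ε ≤ 1 / 10 ^ 11) :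
    16 * (14464 * ((4 : ℝ) + 1) ^ 2 * ((4 : ℝ) + 4) ^ 2) * ε ≤ 3 ∧ 2 * twoLevelSmall 4 2 * ε ≤ ((2 : ℕ) : ℝ) ^ 2 := by
  unfold twoLevelSmall
  constructor <;> · push_cast; nlinarith

end

end Summit.QuantumFields.BalabanUV.T4Continuum.NE3EnergyRateWSupRoutePiFinal
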